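import Literature.Analysis.FluidPDE.PassiveScalarEnergyDecay
import HarnessLib

/-!
# Crux `SelfMixingDichotomy.CoherentScaleExclusion` (stmt-NavierStokesRegularity-1423), line
  `registered`: STUB C `stub_nashCeilingAssembly` — the drift-independent Nash mixing ceiling

Lands `--supports stmt-NavierStokesRegularity-1423` the registered stub `stub_nashCeilingAssembly`
of the lead's skeleton `Cruxes/CoherentScaleExclusion/Lines/birth.lean` (reshape r2): from the
statements of stubs K (`L¹` contraction of passive scalars) and N (Nash inequality on `ℝ³`) as
hypotheses, a DRIFT-INDEPENDENT `δ₀ ∈ (0, 1)` such that every `C¹`, divergence-free, `L²` drift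
`δ`-mixes every blob at every scale `r > 0` for every `δ ≥ δ₀` (`DissipatesAtScale u T x₀ r δ`;
Nash 1958: the `L¹ → L²` smoothing of `∂ₜ − Δ + u·∇` is uniform over divergence-free drifts).

Proof. With `e(s) = ∫ θ(s)²`, `m(s) = ∫ |θ(s)|`, `g(s) = ∫ ‖Dθ(s)‖²` on the window `[a, b]`,
`b − a = r²/2`: `e` is continuous with `e' = −2g` inside (`NashCeiling.hasDerivAt_integral_sq`);
`m(a)² ≤ |B_r| e(a)`, `|B_r| = |B₁| r³` (`NashCeiling.sq_integral_abs_le`); `m(s) ≤ m(a)` (K) and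
`e(s) ≥ e(b)`. If `e(b) > δ² e(a)`, N gives `δ¹⁰ e(a)⁵ < C m(s)⁴ g(s)³ ≤ C W² r⁶ e(a)² g(s)³`
(`W = |B₁| + 1`), hence the floor `g(s) ≥ η e(a)/r²` once `C W² η³ ≤ δ¹⁰`, and integrating,
`e(b) ≤ (1 − η) e(a) ≤ δ² e(a)` once `δ² ≥ 1 − η`: both hold for `δ ≥ δ₀ = 1 − η/2`,
`η = 1/(2 + 1024 C W²)`. Refs: Nash, Amer. J. Math. 80 (1958); CKRZ, Ann. of Math. 168 (2008).
-/

noncomputable section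

open MeasureTheory Set Function Filter Topology InnerProductSpace
open scoped ContDiff Laplacian InnerProductSpace RealInnerProductSpace

-- `Summit = Problem` for this summit; the tree lakefile sets `weak.linter.dupNamespace = false`.
set_option linter.dupNamespace false

namespace Summit.NavierStokesRegularity.NavierStokesRegularity.Theorems

open Literature.Analysis.FluidPDE

namespace NashCeiling

section General

variable {E : Type*} [NormedAddCommGroup E] [InnerProductSpace ℝ E] [FiniteDimensional ℝ E]
  [MeasurableSpace E] [BorelSpace E]

/-- **Energy identity for a passive scalar in a `C¹`, divergence-free, `L²` drift.** Let `θ` be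
jointly smooth with uniform rapid decay on `[a, b] × E`, `a < b`, solving `∂ₜθ + ⟪u, ∇θ⟫ = Δθ`
there (one-sided time derivative within `[a, b]`), the drift being `C¹`, divergence free and square
integrable at each time of the slab. Then `e(t) = ∫ θ(t)²` is continuous on `[a, b]` and
differentiable on `(a, b)` with `e'(s) = −2 ∫ ‖Dθ(s, x)‖² dx` (differentiation under the integral
sign, the equation, `∫ θ Δθ = −∫ ‖Dθ‖²`, `∫ θ ⟪u, ∇θ⟫ = 0`). -/
theorem hasDerivAt_integral_sq {a b : ℝ} (hab : a < b)
    {θ : ℝ → E → ℝ} {u : ℝ → E → E}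
    (hθ : IsSmoothSpaceTimeOn (Set.Icc a b) θ) (hd : HasUniformRapidDecayOn (Set.Icc a b) θ)
    (hpde : ∀ t ∈ Set.Icc a b, ∀ x,
      timeDerivWithin (Set.Icc a b) θ t x + ⟪u t x, gradient (θ t) x⟫ = (Δ (θ t)) x)
    (hu1 : ∀ t ∈ Set.Icc a b, ContDiff ℝ 1 (u t))
    (hdiv : ∀ t ∈ Set.Icc a b, VectorCalculus.IsDivFree (u t))
    (hu2 : ∀ t ∈ Set.Icc a b, MemLp (u t) 2 (volume : Measure E)) :
    ContinuousOn (fun t => ∫ x, (θ t x) ^ 2) (Set.Icc a b) ∧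
      ∀ s ∈ Set.Ioo a b,
        HasDerivAt (fun t => ∫ x, (θ t x) ^ 2) (-2 * ∫ x, ‖fderiv ℝ (θ s) x‖ ^ 2) s := by
  set S : Set ℝ := Icc a b with hS_def
  have hS : UniqueDiffOn ℝ S := uniqueDiffOn_Icc hab
  -- decay exponent and uniform decay constants for `θ`, `Dθ`, `D²θ`, `∂ₜθ`
  set K : ℕ := Module.finrank ℝ E + 1 with hK
  have hr1 : (Module.finrank ℝ E : ℝ) < (K : ℝ) := by rw [hK]; push_cast; linarith
  have hK0 : (0 : ℝ) ≤ (K : ℝ) := Nat.cast_nonneg _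
  obtain ⟨A0, hA0, hA0b⟩ := hd.norm_le_rpow K
  obtain ⟨A1, hA1, hA1b⟩ := hd.norm_fderiv_le_rpow hθ hS K
  obtain ⟨A2, hA2, hA2b⟩ := hd.norm_fderiv_fderiv_le_rpow hθ hS K
  obtain ⟨A3, hA3, hA3b⟩ := hd.norm_timeDerivWithin_le_rpow hθ hS K
  set C : ℝ := A0 + A1 + A2 + A3 with hC_def
  have hC : 0 ≤ C := by rw [hC_def]; positivity
  have h0 : ∀ s ∈ S, ∀ x, ‖θ s x‖ ≤ C * (1 + ‖x‖) ^ (-(K : ℝ)) := fun s hs x =>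
    le_decay_of_le_decay x (hA0b s hs x) (by rw [hC_def]; linarith)
  have h1 : ∀ s ∈ S, ∀ x, ‖fderiv ℝ (θ s) x‖ ≤ C * (1 + ‖x‖) ^ (-(K : ℝ)) :=
    fun s hs x => le_decay_of_le_decay x (hA1b s hs x) (by rw [hC_def]; linarith)
  have h2 : ∀ s ∈ S, ∀ x, ‖fderiv ℝ (fderiv ℝ (θ s)) x‖ ≤ C * (1 + ‖x‖) ^ (-(K : ℝ)) :=
    fun s hs x => le_decay_of_le_decay x (hA2b s hs x) (by rw [hC_def]; linarith)
  have h3 : ∀ s ∈ S, ∀ x, ‖timeDerivWithin S θ s x‖ ≤ C * (1 + ‖x‖) ^ (-(K : ℝ)) :=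
    fun s hs x => le_decay_of_le_decay x (hA3b s hs x) (by rw [hC_def]; linarith)
  -- the energy and the energy production
  set e : ℝ → ℝ := fun s => ∫ x, (θ s x) ^ 2 with he_def
  set φ : ℝ → ℝ := fun s => ∫ x, 2 * (θ s x * timeDerivWithin S θ s x) with hφ_def
  -- continuity in `x` at fixed time, in `t` at fixed `x`
  have hθc : ∀ s ∈ S, Continuous (θ s) := fun s hs => hθ.continuous_slice hs
  have hθ'c : ∀ s ∈ S, Continuous (timeDerivWithin S θ s) := fun s hs =>
    hθ.continuous_timeDerivWithin hS hs
  have hθt_c : ∀ x, ContinuousOn (fun s => θ s x) S := fun x => hθ.continuousOn_time x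
  have hΔc : ∀ s ∈ S, Continuous (fun x => (Δ (θ s)) x) := fun s hs =>
    (hθ.laplacian hS).continuous_slice hs
  -- the dominating function
  set bound : E → ℝ := fun x => 2 * C * C * (1 + ‖x‖) ^ (-(K : ℝ)) with hbound_def
  have hbound : Integrable bound (volume : Measure E) := by
    have := (integrable_one_add_norm (E := E) (μ := volume) hr1).const_mul (2 * C * C)
    simpa [hbound_def] using this
  have hprod : ∀ s ∈ S, ∀ x, ∀ q : ℝ, ‖q‖ ≤ C * (1 + ‖x‖) ^ (-(K : ℝ)) →
      ‖θ s x‖ * ‖q‖ ≤ C * C * (1 + ‖x‖) ^ (-(K : ℝ)) := by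
    intro s hs x q hq
    calc ‖θ s x‖ * ‖q‖ ≤ C * (1 + ‖x‖) ^ (-(K : ℝ)) * (C * (1 + ‖x‖) ^ (-(K : ℝ))) :=
          mul_le_mul (h0 s hs x) hq (norm_nonneg _) (by positivity)
      _ ≤ C * 1 * (C * (1 + ‖x‖) ^ (-(K : ℝ))) := by gcongr; exact rpow_neg_le_one x hK0
      _ = C * C * (1 + ‖x‖) ^ (-(K : ℝ)) := by ring
  have hFle : ∀ s ∈ S, ∀ x, ‖(θ s x) ^ 2‖ ≤ bound x := by
    intro s hs x
    rw [norm_pow, sq, hbound_def]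
    have h1 := hprod s hs x (θ s x) (h0 s hs x)
    have h2' : 0 ≤ C * C * (1 + ‖x‖) ^ (-(K : ℝ)) := by positivity
    nlinarith
  have hF'le : ∀ s ∈ S, ∀ x, ‖2 * (θ s x * timeDerivWithin S θ s x)‖ ≤ bound x := by
    intro s hs x
    rw [norm_mul, Real.norm_two, norm_mul, hbound_def]
    have h1 := hprod s hs x (timeDerivWithin S θ s x) (h3 s hs x)
    nlinarith
  have hIe : ∀ s ∈ S, Integrable (fun x => (θ s x) ^ 2) (volume : Measure E) := fun s hs =>
    Integrable.mono' hbound ((hθc s hs).pow 2).aestronglyMeasurable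
      (Eventually.of_forall (hFle s hs))
  -- (B1) the energy is continuous on `[a, b]`
  have hB1 : ContinuousOn e S := by
    refine continuousOn_of_dominated (bound := bound) (fun s hs => ?_) (fun s hs => ?_) hbound ?_
    · exact ((hθc s hs).pow 2).aestronglyMeasurable
    · exact Eventually.of_forall (hFle s hs)
    · exact Eventually.of_forall fun x => (hθt_c x).pow 2
  -- (B2) the energy is differentiable on `(a, b)` with derivative `φ`
  have hB2 : ∀ s ∈ Ioo a b, HasDerivAt e (φ s) s := by
    intro s hs
    have hsS : s ∈ S := Ioo_subset_Icc_self hs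
    have hIoo : Ioo a b ∈ 𝓝 s := Ioo_mem_nhds hs.1 hs.2
    have key := hasDerivAt_integral_of_dominated_loc_of_deriv_le (μ := (volume : Measure E))
      (F := fun σ x => (θ σ x) ^ 2) (F' := fun σ x => 2 * (θ σ x * timeDerivWithin S θ σ x))
      (x₀ := s) (bound := bound) hIoo ?_ (hIe s hsS) ?_ ?_ hbound ?_
    · exact key.2
    · filter_upwards [hIoo] with σ hσ
      exact ((hθc σ (Ioo_subset_Icc_self hσ)).pow 2).aestronglyMeasurable
    · exact (continuous_const.mul ((hθc s hsS).mul (hθ'c s hsS))).aestronglyMeasurable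
    · exact Eventually.of_forall fun x σ hσ => hF'le σ (Ioo_subset_Icc_self hσ) x
    · refine Eventually.of_forall fun x σ hσ => ?_
      have h1 : HasDerivAt (fun τ => θ τ x) (timeDerivWithin S θ σ x) σ :=
        (hθ.hasDerivWithinAt_timeDerivWithin hS (Ioo_subset_Icc_self hσ) x).hasDerivAt
          (Icc_mem_nhds hσ.1 hσ.2)
      have hfeq : (fun τ => θ τ x ^ 2) = fun τ => θ τ x * θ τ x := funext fun τ => sq _
      show HasDerivAt (fun τ => θ τ x ^ 2) (2 * (θ σ x * timeDerivWithin S θ σ x)) σ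
      rw [hfeq]
      exact (h1.fun_mul h1).congr_deriv (by ring)
  refine ⟨hB1, fun s hs => ?_⟩
  -- (B3) the value of the energy production: `φ s = -2 ∫ ‖Dθ‖²`
  have hsS : s ∈ S := Ioo_subset_Icc_self hs
  have hθ1 : ContDiff ℝ 1 (θ s) := contDiff_infty.1 (hθ.contDiff_slice hsS) 1
  have hθ2 : ContDiff ℝ 2 (θ s) := contDiff_infty.1 (hθ.contDiff_slice hsS) 2
  have hpt : ∀ x, timeDerivWithin S θ s x = (Δ (θ s)) x - ⟪u s x, gradient (θ s) x⟫ :=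
    fun x => eq_sub_of_add_eq (hpde s hsS x)
  -- integrability of `θ Δθ` and `θ ∂ₜθ`
  have hIΔ : Integrable (fun x => θ s x * (Δ (θ s)) x) (volume : Measure E) := by
    refine integrable_of_norm_le_decay_mul_decay (C₁ := C) (C₂ := Module.finrank ℝ E * C)
      (r := K) (r' := K) ((hθc s hsS).mul (hΔc s hsS)) hr1 hK0 hC (by positivity) fun x => ?_
    rw [norm_mul]
    refine mul_le_mul (h0 s hsS x) ((norm_laplacian_le (θ s) x).trans ?_) (norm_nonneg _)
      (by positivity)
    rw [mul_assoc]
    gcongr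
    exact h2 s hsS x
  have hIt : Integrable (fun x => θ s x * timeDerivWithin S θ s x) (volume : Measure E) := by
    refine integrable_of_norm_le_decay_mul_decay (C₁ := C) (C₂ := C) (r := K) (r' := K)
      ((hθc s hsS).mul (hθ'c s hsS)) hr1 hK0 hC hC fun x => ?_
    rw [norm_mul]
    exact mul_le_mul (h0 s hsS x) (h3 s hsS x) (norm_nonneg _) (by positivity)
  -- the transport pairing vanishes and the dissipation pairing is `-∫ ‖Dθ‖²`
  have htr : ∫ x, θ s x * ⟪u s x, gradient (θ s) x⟫ = 0 :=
    integral_mul_inner_gradient_eq_zero_of_memLp (hu1 s hsS) (hdiv s hsS) (hu2 s hsS) hθ1 hC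
      hr1 (h0 s hsS) (h1 s hsS)
  have hlap : ∫ x, θ s x * (Δ (θ s)) x = -∫ x, ‖fderiv ℝ (θ s) x‖ ^ 2 :=
    integral_mul_laplacian_self_eq_neg_integral_norm_fderiv_sq hθ2 hC hr1 (h0 s hsS) (h1 s hsS)
      (h2 s hsS)
  -- `∫ θ ∂ₜθ - ∫ θ Δθ = -∫ θ ⟪u, ∇θ⟫ = 0`, so `φ s = 2 ∫ θ ∂ₜθ = -2 ∫ ‖Dθ‖²`
  have hkey : (∫ x, θ s x * timeDerivWithin S θ s x) - ∫ x, θ s x * (Δ (θ s)) x = 0 := by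
    have hfun : (fun x => θ s x * timeDerivWithin S θ s x - θ s x * (Δ (θ s)) x) =
        fun x => -(θ s x * ⟪u s x, gradient (θ s) x⟫) := by
      funext x; rw [hpt x]; ring
    rw [← integral_sub hIt hIΔ, hfun, integral_neg, htr, neg_zero]
  have hval : φ s = -2 * ∫ x, ‖fderiv ℝ (θ s) x‖ ^ 2 := by
    rw [show φ s = 2 * ∫ x, θ s x * timeDerivWithin S θ s x from integral_const_mul _ _]
    linarith
  rw [← hval]
  exact hB2 s hs

/-- At each time of the slab, a jointly smooth scalar with uniform rapid decay has an integrable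
slice, an integrable squared slice and a square-integrable spatial derivative (domination by
`(1 + ‖x‖)^{-(dim E + 1)}`). -/
theorem integrable_slice {a b : ℝ} (hab : a < b) {θ : ℝ → E → ℝ}
    (hθ : IsSmoothSpaceTimeOn (Set.Icc a b) θ) (hd : HasUniformRapidDecayOn (Set.Icc a b) θ)
    {s : ℝ} (hs : s ∈ Set.Icc a b) :
    Integrable (θ s) (volume : Measure E) ∧
      Integrable (fun x => (θ s x) ^ 2) (volume : Measure E) ∧
      Integrable (fun x => ‖fderiv ℝ (θ s) x‖ ^ 2) (volume : Measure E) := by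
  have hS : UniqueDiffOn ℝ (Set.Icc a b) := uniqueDiffOn_Icc hab
  set K : ℕ := Module.finrank ℝ E + 1 with hK
  have hr1 : (Module.finrank ℝ E : ℝ) < (K : ℝ) := by rw [hK]; push_cast; linarith
  have hK0 : (0 : ℝ) ≤ (K : ℝ) := Nat.cast_nonneg _
  obtain ⟨A0, hA0, hA0b⟩ := hd.norm_le_rpow K
  obtain ⟨A1, hA1, hA1b⟩ := hd.norm_fderiv_le_rpow hθ hS K
  have hθc : Continuous (θ s) := hθ.continuous_slice hs
  have hDc : Continuous (fderiv ℝ (θ s)) := hθ.continuous_fderiv_slice hs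
  refine ⟨integrable_of_norm_le_rpow_neg hθc hr1 (hA0b s hs), ?_, ?_⟩
  · refine integrable_of_norm_le_decay_mul_decay (C₁ := A0) (C₂ := A0) (r := K) (r' := K)
      (hθc.pow 2) hr1 hK0 hA0 hA0 fun x => ?_
    rw [norm_pow, sq]
    exact mul_le_mul (hA0b s hs x) (hA0b s hs x) (norm_nonneg _) (by positivity)
  · refine integrable_of_norm_le_decay_mul_decay (C₁ := A1) (C₂ := A1) (r := K) (r' := K)
      (hDc.norm.pow 2) hr1 hK0 hA1 hA1 fun x => ?_
    rw [norm_pow, norm_norm, sq]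
    exact mul_le_mul (hA1b s hs x) (hA1b s hs x) (norm_nonneg _) (by positivity)

/-- **Cauchy–Schwarz on a set of finite measure carrying the support**: if `f` vanishes outside a
measurable set `A` of finite measure and `f`, `f²` are integrable, then `(∫ |f|)² ≤ |A| · ∫ f²`.
Proof without square roots: `2 l |f| ≤ l² f² + 1_A` pointwise for every real `l`, so
`2 l ∫|f| ≤ l² ∫f² + |A|`, and the discriminant of this quadratic in `l` is nonpositive. -/
theorem sq_integral_abs_le {f : E → ℝ} {A : Set E} (hAm : MeasurableSet A)
    (hA : volume A ≠ ⊤) (hsupp : Function.support f ⊆ A)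
    (hf : Integrable f (volume : Measure E))
    (hf2 : Integrable (fun x => (f x) ^ 2) (volume : Measure E)) :
    (∫ x, |f x|) ^ 2 ≤ (volume A).toReal * ∫ x, (f x) ^ 2 := by
  have hI1 : Integrable (A.indicator fun _ => (1 : ℝ)) (volume : Measure E) :=
    (integrableOn_const hA).integrable_indicator hAm
  have hV : ∫ x, A.indicator (fun _ => (1 : ℝ)) x = (volume A).toReal := by
    rw [integral_indicator_const _ hAm, smul_eq_mul, mul_one, measureReal_def]
  -- the pointwise inequality `2 l |f| ≤ l² f² + 1_A`
  have hpt : ∀ (l : ℝ) (x : E),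
      2 * l * |f x| ≤ l ^ 2 * (f x) ^ 2 + A.indicator (fun _ => (1 : ℝ)) x := by
    intro l x
    by_cases hx : x ∈ A
    · rw [indicator_of_mem hx]
      nlinarith [sq_nonneg (l * |f x| - 1), sq_abs (f x)]
    · have hfx : f x = 0 := Function.notMem_support.1 fun h => hx (hsupp h)
      rw [indicator_of_notMem hx, hfx]
      simp
  -- integrate
  have hint : ∀ l : ℝ,
      2 * l * ∫ x, |f x| ≤ l ^ 2 * (∫ x, (f x) ^ 2) + (volume A).toReal := by
    intro l
    calc 2 * l * ∫ x, |f x| = ∫ x, 2 * l * |f x| := (integral_const_mul _ _).symm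
      _ ≤ ∫ x, (l ^ 2 * (f x) ^ 2 + A.indicator (fun _ => (1 : ℝ)) x) :=
          integral_mono (hf.abs.const_mul _) ((hf2.const_mul _).add hI1) (hpt l)
      _ = l ^ 2 * (∫ x, (f x) ^ 2) + (volume A).toReal := by
          rw [integral_add (hf2.const_mul _) hI1, integral_const_mul, hV]
  -- the discriminant of the nonnegative quadratic `l ↦ e l² - 2 m l + |A|` is nonpositive
  have hdisc := discrim_le_zero (a := ∫ x, (f x) ^ 2) (b := -2 * ∫ x, |f x|)
    (c := (volume A).toReal) fun l => by have := hint l; nlinarith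
  rw [discrim] at hdisc
  nlinarith [hdisc]

end General

end NashCeiling

/-- **stub C — `stub_nashCeilingAssembly`: the drift-independent mixing ceiling from K and N**
(registered stub of `Cruxes/CoherentScaleExclusion/Lines/birth.lean`, reshape r2). From the
statements of stubs K (the `L¹` norm of a passive scalar in a `C¹`, divergence-free, `L²` drift
is nonincreasing) and N (the Nash inequality `(∫ f²)⁵ ≤ C (∫ |f|)⁴ (∫ ‖Df‖²)³` on `ℝ³`) as
hypotheses: there is `δ₀ ∈ (0, 1)` such that for every `δ ≥ δ₀`, every drift `u` that is `C¹`,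
divergence free and square integrable at each time of the window `[T − r², T − r²/2]`, every
`x₀` and every `r > 0`, `DissipatesAtScale u T x₀ r δ`. Here `δ₀ = 1 − η/2`,
`η = 1/(2 + 1024 C W²)`, `W = |B₁| + 1`: if an admissible blob kept more than the fraction `δ²`
of its energy `e₀`, Nash + `L¹` contraction + Cauchy–Schwarz on the initial support would force
`∫ ‖Dθ(s)‖² ≥ η e₀ / r²` throughout the window, and integrating `e' = −2 ∫ ‖Dθ‖²` over its length
`r²/2` would give `e(T − r²/2) ≤ (1 − η) e₀ ≤ δ² e₀` (Nash 1958). -/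
theorem stub_nashCeilingAssembly :
    (∀ (a b : ℝ), a < b →
      ∀ (u : ℝ → EuclideanSpace ℝ (Fin 3) → EuclideanSpace ℝ (Fin 3))
        (θ : ℝ → EuclideanSpace ℝ (Fin 3) → ℝ),
      Literature.Analysis.FluidPDE.IsSmoothSpaceTimeOn (Set.Icc a b) θ →
      Literature.Analysis.FluidPDE.HasUniformRapidDecayOn (Set.Icc a b) θ →
      (∀ t ∈ Set.Icc a b, ∀ x : EuclideanSpace ℝ (Fin 3),
        Literature.Analysis.FluidPDE.timeDerivWithin (Set.Icc a b) θ t x +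
            inner ℝ (u t x) (gradient (θ t) x) =
          Laplacian.laplacian (θ t) x) →
      (∀ t ∈ Set.Icc a b, ContDiff ℝ 1 (u t)) →
      (∀ t ∈ Set.Icc a b, Literature.Analysis.FluidPDE.VectorCalculus.IsDivFree (u t)) →
      (∀ t ∈ Set.Icc a b, MeasureTheory.MemLp (u t) 2 MeasureTheory.volume) →
      AntitoneOn (fun t => ∫ x, |θ t x|) (Set.Icc a b)) →
    (∃ C : ℝ, 0 < C ∧ ∀ f : EuclideanSpace ℝ (Fin 3) → ℝ, ContDiff ℝ 1 f →
      MeasureTheory.Integrable f MeasureTheory.volume →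
      MeasureTheory.Integrable (fun x => (f x) ^ 2) MeasureTheory.volume →
      MeasureTheory.Integrable (fun x => ‖fderiv ℝ f x‖ ^ 2) MeasureTheory.volume →
      (∫ x, (f x) ^ 2) ^ 5 ≤ C * (∫ x, |f x|) ^ 4 * (∫ x, ‖fderiv ℝ f x‖ ^ 2) ^ 3) →
    ∃ δ₀ : ℝ, 0 < δ₀ ∧ δ₀ < 1 ∧ ∀ δ : ℝ, δ₀ ≤ δ →
      ∀ (u : ℝ → EuclideanSpace ℝ (Fin 3) → EuclideanSpace ℝ (Fin 3)) (T : ℝ)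
        (x₀ : EuclideanSpace ℝ (Fin 3)) (r : ℝ), 0 < r →
      (∀ t ∈ Set.Icc (T - r ^ 2) (T - r ^ 2 / 2), ContDiff ℝ 1 (u t)) →
      (∀ t ∈ Set.Icc (T - r ^ 2) (T - r ^ 2 / 2),
        Literature.Analysis.FluidPDE.VectorCalculus.IsDivFree (u t)) →
      (∀ t ∈ Set.Icc (T - r ^ 2) (T - r ^ 2 / 2),
        MeasureTheory.MemLp (u t) 2 MeasureTheory.volume) →
      Literature.Analysis.FluidPDE.DissipatesAtScale u T x₀ r δ := by
  intro hK hN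
  obtain ⟨C, hC, hNash⟩ := hN
  -- the constants `W = |B₁| + 1`, `η = 1 / (2 + 1024 C W²)`, `δ₀ = 1 - η / 2`
  obtain ⟨W, hW1, hW0⟩ : ∃ W : ℝ,
      (volume (Metric.ball (0 : EuclideanSpace ℝ (Fin 3)) 1)).toReal ≤ W ∧ 0 < W :=
    ⟨_ + 1, le_add_of_nonneg_right zero_le_one,
      add_pos_of_nonneg_of_pos ENNReal.toReal_nonneg one_pos⟩
  obtain ⟨η, hη0, hη1, hηD⟩ : ∃ η : ℝ, 0 < η ∧ η ≤ 1 / 2 ∧ η * (C * W ^ 2) ≤ 1 / 1024 := by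
    refine ⟨1 / (2 + 1024 * (C * W ^ 2)), by positivity,
      one_div_le_one_div_of_le two_pos (by nlinarith), ?_⟩
    rw [div_mul_eq_mul_div, one_mul, div_le_div_iff₀ (by positivity) (by norm_num)]
    nlinarith
  refine ⟨1 - η / 2, by linarith, by linarith, ?_⟩
  intro δ hδ u T x₀ r hr hu1 hdiv hu2
  have hδ2 : 1 - η ≤ δ ^ 2 := by
    nlinarith [mul_nonneg (sub_nonneg.2 hδ) (by linarith : (0 : ℝ) ≤ δ + (1 - η / 2))]
  have hδ10 : (1 : ℝ) / 1024 ≤ δ ^ 10 := by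
    have h := pow_le_pow_left₀ (by norm_num : (0 : ℝ) ≤ 1 / 2) (show 1 / 2 ≤ δ by linarith) 10
    norm_num at h
    exact h
  have hr0 : r ≠ 0 := hr.ne'
  -- `|B_r(x₀)| = |B₁| r³ ≤ W r³`
  have hvol : (volume (Metric.ball x₀ r)).toReal ≤ W * r ^ 3 := by
    rw [Measure.addHaar_ball_of_pos volume x₀ hr, finrank_euclideanSpace_fin, ENNReal.toReal_mul,
      ENNReal.toReal_ofReal (by positivity), mul_comm]
    exact mul_le_mul_of_nonneg_right hW1 (by positivity)
  have hvol' : volume (Metric.ball x₀ r) ≠ ⊤ := measure_ball_lt_top.ne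
  intro θ hθ hd hpde hsupp
  -- the window `[a, b]`, `b - a = r² / 2`
  have hlen : (T - r ^ 2 / 2) - (T - r ^ 2) = r ^ 2 / 2 := by ring
  generalize ha : T - r ^ 2 = a at *
  generalize hb : T - r ^ 2 / 2 = b at *
  have hab : a < b := by nlinarith [pow_pos hr 2]
  have haS : a ∈ Set.Icc a b := left_mem_Icc.2 hab.le
  have hbS : b ∈ Set.Icc a b := right_mem_Icc.2 hab.le
  -- K: the `L¹` norm is nonincreasing; the energy is nonincreasing, continuous, `e' = -2 g`
  have hm_anti := hK a b hab u θ hθ hd hpde hu1 hdiv hu2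
  have he_anti := antitoneOn_integral_sq_of_isDivFree_memLp hab hθ hd hpde hu1 hdiv hu2
  obtain ⟨he_cont, he_deriv⟩ := NashCeiling.hasDerivAt_integral_sq hab hθ hd hpde hu1 hdiv hu2
  set e₀ : ℝ := ∫ x, (θ a x) ^ 2 with he₀_def
  have he₀0 : 0 ≤ e₀ := integral_nonneg fun _ => sq_nonneg _
  -- Cauchy–Schwarz at the initial time: `m(a)² ≤ W r³ e₀`
  have hCS : (∫ x, |θ a x|) ^ 2 ≤ W * r ^ 3 * e₀ := by
    obtain ⟨hi1, hi2, -⟩ := NashCeiling.integrable_slice hab hθ hd haS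
    exact (NashCeiling.sq_integral_abs_le measurableSet_ball hvol' hsupp hi1 hi2).trans
      (mul_le_mul_of_nonneg_right hvol he₀0)
  -- suppose the blob keeps more than the fraction `δ²` of its energy
  by_contra H
  push Not at H
  -- N at each time of the window: `δ¹⁰ e₀⁵ < C W² r⁶ e₀² g(s)³`
  have key : ∀ s ∈ Set.Icc a b,
      δ ^ 10 * e₀ ^ 5 < C * W ^ 2 * r ^ 6 * e₀ ^ 2 * (∫ x, ‖fderiv ℝ (θ s) x‖ ^ 2) ^ 3 := by
    intro s hs
    obtain ⟨hi1, hi2, hi3⟩ := NashCeiling.integrable_slice hab hθ hd hs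
    have hN := hNash (θ s) (contDiff_infty.1 (hθ.contDiff_slice hs) 1) hi1 hi2 hi3
    have hes : δ ^ 2 * e₀ < ∫ x, (θ s x) ^ 2 := H.trans_le (he_anti hs hbS hs.2)
    have hm4 : (∫ x, |θ s x|) ^ 4 ≤ (W * r ^ 3 * e₀) ^ 2 :=
      calc (∫ x, |θ s x|) ^ 4 ≤ (∫ x, |θ a x|) ^ 4 :=
            pow_le_pow_left₀ (integral_nonneg fun _ => abs_nonneg _) (hm_anti haS hs hs.1) 4
        _ = ((∫ x, |θ a x|) ^ 2) ^ 2 := by ring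
        _ ≤ (W * r ^ 3 * e₀) ^ 2 := pow_le_pow_left₀ (sq_nonneg _) hCS 2
    have hg0 : 0 ≤ ∫ x, ‖fderiv ℝ (θ s) x‖ ^ 2 := integral_nonneg fun _ => sq_nonneg _
    calc δ ^ 10 * e₀ ^ 5 = (δ ^ 2 * e₀) ^ 5 := by ring
      _ < (∫ x, (θ s x) ^ 2) ^ 5 :=
          pow_lt_pow_left₀ hes (mul_nonneg (sq_nonneg δ) he₀0) (by norm_num)
      _ ≤ C * (∫ x, |θ s x|) ^ 4 * (∫ x, ‖fderiv ℝ (θ s) x‖ ^ 2) ^ 3 := hN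
      _ ≤ C * (W * r ^ 3 * e₀) ^ 2 * (∫ x, ‖fderiv ℝ (θ s) x‖ ^ 2) ^ 3 :=
          mul_le_mul_of_nonneg_right (mul_le_mul_of_nonneg_left hm4 hC.le) (pow_nonneg hg0 3)
      _ = C * W ^ 2 * r ^ 6 * e₀ ^ 2 * (∫ x, ‖fderiv ℝ (θ s) x‖ ^ 2) ^ 3 := by ring
  -- the dissipation floor `g(s) ≥ η e₀ / r²` inside the window
  have hfloor : ∀ s ∈ Set.Ioo a b, η * e₀ / r ^ 2 ≤ ∫ x, ‖fderiv ℝ (θ s) x‖ ^ 2 := by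
    intro s hs
    have hg0 : 0 ≤ ∫ x, ‖fderiv ℝ (θ s) x‖ ^ 2 := integral_nonneg fun _ => sq_nonneg _
    by_contra hlt
    push Not at hlt
    have hk := key s (Ioo_subset_Icc_self hs)
    have h4 : C * W ^ 2 * r ^ 6 * e₀ ^ 2 * (∫ x, ‖fderiv ℝ (θ s) x‖ ^ 2) ^ 3 ≤
        C * W ^ 2 * r ^ 6 * e₀ ^ 2 * (η * e₀ / r ^ 2) ^ 3 :=
      mul_le_mul_of_nonneg_left (pow_lt_pow_left₀ hlt hg0 (by norm_num)).le (by positivity)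
    have h5 : C * W ^ 2 * r ^ 6 * e₀ ^ 2 * (η * e₀ / r ^ 2) ^ 3 =
        η * (C * W ^ 2) * η ^ 2 * e₀ ^ 5 := by
      field_simp
    have h6 : η * (C * W ^ 2) * η ^ 2 * e₀ ^ 5 ≤ 1 / 1024 * (1 / 2) ^ 2 * e₀ ^ 5 :=
      mul_le_mul_of_nonneg_right
        (mul_le_mul hηD (pow_le_pow_left₀ hη0.le hη1 2) (by positivity) (by norm_num))
        (by positivity)
    have h7 : 1 / 1024 * e₀ ^ 5 ≤ δ ^ 10 * e₀ ^ 5 :=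
      mul_le_mul_of_nonneg_right hδ10 (by positivity)
    linarith [pow_nonneg he₀0 5]
  -- integrate the floor over the window: `e(b) - e₀ ≤ -2 (η e₀ / r²) (b - a) = -η e₀`
  have hdec : (∫ x, (θ b x) ^ 2) - e₀ ≤ -(2 * (η * e₀ / r ^ 2)) * (b - a) := by
    refine (convex_Icc a b).image_sub_le_mul_sub_of_deriv_le he_cont ?_ ?_ a haS b hbS hab.le
    · rw [interior_Icc]
      exact fun s hs => (he_deriv s hs).differentiableAt.differentiableWithinAt
    · rw [interior_Icc]
      intro s hs
      rw [(he_deriv s hs).deriv]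
      linarith [hfloor s hs]
  have hprod : -(2 * (η * e₀ / r ^ 2)) * (b - a) = -(η * e₀) := by
    rw [show b - a = r ^ 2 / 2 by linarith]
    field_simp
  rw [hprod] at hdec
  -- `e(b) ≤ (1 - η) e₀ ≤ δ² e₀ < e(b)`
  linarith [mul_le_mul_of_nonneg_right hδ2 he₀0]

end Summit.NavierStokesRegularity.NavierStokesRegularity.Theorems
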